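import Literature.AlgebraicGeometry.Frobenioids.ModelFrobenioidBaseSectionThrough
import Literature.AnabelianGeometry.EtaleTheta.BiKummerThm44SubModelPull

/-!
# [EtTh] Theorem 4.4 (iii): sub-DAG row T44-L15b `Thm44Hyp.PreservesNHSaturatedBsFld` PROVED for two canonical
# models AT THE ROOTS READING of the `(N, H_⊙^{bs-fld})`-saturation slot

S. Mochizuki, *The étale theta function and its Frobenioid-theoretic manifestations*, Publ. RIMS **45** (2009)
[MochizukiEtTh2009], §4, Thm 4.4 (iii) PDF p.94 («`A₁` is `(N, H_{⊙,1}, f₁)`-saturated if and only if `A₂` is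
`(N, H_{⊙,2}, f₂)`-saturated»), proof p.95 ll.14–16: «the "manifestly category-theoretic nature" of
"`(N, H^{bs-fld}_{⊙,i})`-saturation" [cf. [FrdII], Definition 2.2, (ii); [AbsAnab], Lemma 1.3.8]».  abc-iut cell,
layer L2, plan/L2/SUBDAG-EtTh-Thm44.md (custodian abc-iut-w5-d179) row **T44-L15b** — after v7.1 (p429785) the LAST
binder of T44-L14 at the canonical model besides T44-L09c.  Seat abc-iut-w4-d044 (gen 3), offer (b) / L2-lead
07:15:11Z.  PROOF-ONLY file (0 `def`s); abc-iut-w5-d179's `Thm44Hyp.psiVal` / `psiVal_frac` / `psiVal_map_baseMap`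
(p424788, p429785) and abc-iut-L2-t3's `Thm44Hyp` API are CONSUMED BY NAME; nothing landed is edited or restated.

## The reading (HONEST LABEL — same as `Discharge/Sec4Prop42SubRootsReading.lean`, p428987)

The `(N, H_⊙^{bs-fld})`-saturation predicate is a FREE field of `BiKummerSetting` (TODO-merge(abc-iut-L1-t4)) and a
parameter `NH` of `mkOfModelCanonical`; T44-L15b asks that `Ψ` carry it from `A''` to any `B'' ≅ Ψ(A'')` — over
two ABSTRACT predicates nothing can be proved (cf. abc-iut-f-110's kernel certificate `not_forall_thm44_iii`,
p429868).  Here BOTH canonical models carry the ROOTS READING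

  `NH_i A N := ∀ (g : A^bs ⟶ A_{⊙,i}^bs) (ξ ∈ B_i(A_{⊙,i}^bs)), Div_B ξ = 1 → ∃ ζ ∈ B_i(A^bs), ζ^N = B_i(g)(ξ)`

(the consequence [FrdII] Rmk 2.2.1 draws from Def 2.2 (ii)(c), combined with [EtTh] Prop 3.4 (ii); WEAKER than
print's cohomological definition; exactly what Prop 4.2 (iv) uses) — and AT THIS READING print's «manifestly
category-theoretic nature» becomes a kernel theorem: `Thm44Hyp.preservesNHSaturatedBsFld_rootsReading`.  Nothing
here claims the reading IS [FrdII] Def 2.2 (ii); at the faithful reading T44-L15b stays the [FrdII] Def 2.2 (ii) /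
[AbsAnab] Lem 1.3.8 input (abc-iut-L1-t4 / L4).  No new `def … : Prop` (D-0067 (5)).

## Route (ANY pair of §4 settings for the transport lemmas; the reading only in the final theorem)

* `Div_B`-trivial elements of `B(A^bs)` are the unit parts `u_σ` of the base-identity linear isometries
  `σ = (1, id, 0, ξ) ∈ O^×(A)` ([FrdI] Thm 5.2 (i) relation; `exists_preStep_baseIdentity_unit_eq`,
  `divB_unit_eq_one_of_baseIdentity`), and `ψ = psiVal` carries `u_σ ↦ u_{Ψ σ}` (`psiVal_unit_eq_unit_map`, from
  abc-iut-w5-d179's `psiVal_frac` with `s'' = id`) — so `ψ` preserves AND (`Ψ` full, isomorphisms reflected)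
  reflects `Div_B`-triviality (`divB_psiVal_eq_one`, `exists_psiVal_eq_of_divB_eq_one`);
* base arrows `A''^bs ⟶ A_{⊙,1}^bs` lift to `C₁`-arrows between the principal objects `A''`, `A_{⊙,1}`
  (`exists_hom_baseMap_eq_of_isFrobeniusTrivial`) and are matched by `Ψ^bs` (`cmp`, `base_map_Ψ_cmp`, `mapsAodot`)
  with base arrows `B''^bs ⟶ A_{⊙,2}^bs`;
* roots are transported by `ψ_{A''}` along `psiVal_map_baseMap` (p429785) and moved along `B(Base e)` for the
  isomorph `e : Ψ(A'') ≅ B''`; both directions.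

COROLLARY (`Thm44Hyp.preservesNthRoots_mkOfModelCanonical_rootsReading`): with abc-iut-w5-d179's
`preservesNthRoots_mkOfModelCanonical` (p429785), T44-L14 at the canonical tree-vocabulary models AT THE ROOTS
READING ⇐ {`Remark372 D₀ / D₀'`, `hBmon₁ / hBmon₂`, `Φ_i` perf-factorial, T44-L09c `GaloisCompatible`} — the
T44-L15b binder gone at that reading.  Since abc-iut-L2-t4's `mkOfConnectedTemperoid X tf hZ hP NH A₀ …`
(`Discharge/Sec5OfConnectedTemperoid.lean`) IS `mkOfModelCanonical` at the connected temperoid base (definitionally,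
`NH` free), `preservesNHSaturatedBsFld_rootsReading` applies verbatim to the GENUINE connected base of
abc-iut-w5-d179's `thm44_mkOfConnectedTemperoid` (p431376, SUBDAG v7.3: T44-L15b = the last named input of
Thm 4.4 (iii)/T44-L14 there) once both settings carry the roots reading — not restated here (import kept minimal).

HONEST FRAMING: refereed pre-IUT material ([EtTh] §4 over [FrdI]/[FrdII]); a READING of a free interface slot,
labelled in the theorem name; nothing here bears on [IUTchIII] Cor. 3.12; typed ≠ proved — here PROVED at the
reading.
-/

noncomputable section

namespace Literature.AnabelianGeometry.EtaleTheta

open CategoryTheory Opposite Literature.AlgebraicGeometry.Frobenioids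

namespace BiKummerSetting

universe u₀ v₀ u v w

variable {K : Type u₀} [Field K] {K' : Type u₀} [Field K'] {D₀ : Type u₀} [Category.{v₀} D₀]
  {V : FrdIMonoidStub.{w}}
  {X₁ : SemiGraphs.TemperedArithmeticGroup.{u₀} K} {X₂ : SemiGraphs.TemperedArithmeticGroup.{u₀} K'}
  {D₀' : Type u₀} [Category.{v₀} D₀']
  {T₁ : RealifiedDivisorMonoids (D₀ := D₀) V} {T₂ : RealifiedDivisorMonoids (D₀ := D₀') V}
  {D₁ D₂ : Type u} [Category.{v} D₁] [Category.{v} D₂] {VD₁ : FrdICatStub.{u, v, w} D₁}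
  {VD₂ : FrdICatStub.{u, v, w} D₂}

/-! ### Model lemmas (one setting): `Div_B`-trivial elements as unit parts of base-identity linear isometries -/

section OneSetting

variable {S : BiKummerSetting X₁ T₁ D₁ VD₁}

/-- **`Ker Div_B ⊆` unit parts** ([FrdI] Thm 5.2 (i)): for `ξ ∈ B(A^bs)` with `Div_B ξ = 1`, the arrow
`(1, id, 0, ξ) : A → A` is a (base-identity, isometric) pre-step of the model Frobenioid with unit part `ξ`.
[cite: MochizukiFrdI2008, Thm. 5.2(i) p.100] -/
theorem exists_preStep_baseIdentity_unit_eq (A : S.C) (ξ : S.tf.ratFnFunctor.obj (op A.base))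
    (hξ : divB S.tf.divisorMonoid S.tf.ratFnFunctor S.tf.divBNatTrans (op A.base) ξ = 1) :
    ∃ σ : A ⟶ A, S.IsPreStep σ ∧ ModelFrobenioid.baseMap σ = 𝟙 _ ∧ S.IsIsometry σ ∧ ModelFrobenioid.unit σ = ξ := by
  let σ : A ⟶ A := ModelFrobenioid.mkHom A A 1 (𝟙 _) 1 ξ (by
    rw [PNat.one_coe, pow_one, map_one, mul_one, pullGp_id, hξ, mul_one])
  exact ⟨σ, ⟨rfl, show IsIso (𝟙 A.base) from inferInstance⟩, rfl, rfl, rfl⟩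

/-- **Unit parts `⊆ Ker Div_B`** ([FrdI] Thm 5.2 (i) relation (d)): a LINEAR base-identity ISOMETRY
`τ = (1, id, 0, u_τ) : A → A` has `Div_B(u_τ) = 1` (`α · 0 = id^*α · Div_B(u_τ)` in the group `Φ(A^bs)^gp`).
[cite: MochizukiFrdI2008, Thm. 5.2(i) p.100] -/
theorem divB_unit_eq_one_of_baseIdentity {A : S.C} (τ : A ⟶ A) (hlin : S.IsLinear τ)
    (hb : ModelFrobenioid.baseMap τ = 𝟙 _) (hiso : S.IsIsometry τ) :
    divB S.tf.divisorMonoid S.tf.ratFnFunctor S.tf.divBNatTrans (op A.base) (ModelFrobenioid.unit τ) = 1 := by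
  have h1 : ModelFrobenioid.degFr τ = 1 := hlin
  have h2 : ModelFrobenioid.div τ = 1 := hiso
  have hrel := ModelFrobenioid.rel τ
  rw [h1, h2, PNat.one_coe, pow_one, map_one, mul_one, hb, pullGp_id] at hrel
  exact (mul_eq_left.mp hrel.symm)

/-- **Arrows between principal objects over any base arrow** ([FrdI] Thm 5.2 (i); `B` group-like): for
Frobenius-trivial `A = (A_D, Div_B(a))`, `B = (B_D, Div_B(b))` and `g : A_D → B_D` the arrow `(1, g, 0, a·(g^*b)⁻¹)`
lies over `g`. [cite: MochizukiFrdI2008, Thm. 5.2(i) p.100] -/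
theorem exists_hom_baseMap_eq_of_isFrobeniusTrivial
    (hBg : Objectwise (fun M _ => IsGroupLike M) S.tf.ratFnFunctor) {A B : S.C}
    (hA : S.IsFrobeniusTrivial A) (hB : S.IsFrobeniusTrivial B) (g : A.base ⟶ B.base) :
    ∃ φ : A ⟶ B, ModelFrobenioid.baseMap φ = g := by
  obtain ⟨a, ha⟩ := ModelFrobenioid.exists_cls_eq_divB_of_isFrobeniusTrivial A hA
  obtain ⟨b, hb⟩ := ModelFrobenioid.exists_cls_eq_divB_of_isFrobeniusTrivial B hB
  obtain ⟨w, hw⟩ := (hBg A.base).isUnit (pull S.tf.ratFnFunctor g b)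
  exact ⟨ModelFrobenioid.mkHom A B 1 g 1 (a * ↑w⁻¹) (by
    rw [PNat.one_coe, pow_one, map_one, mul_one, ha, hb, ModelFrobenioid.pullGp_divB_pull, ← hw, ← map_mul,
      mul_left_comm, Units.mul_inv, mul_one]), rfl⟩

end OneSetting

/-! ### Transport lemmas for `ψ = psiVal` (ANY pair of settings): `Div_B`-triviality is preserved and reflected -/

section AnySetting

variable {S₁ : BiKummerSetting X₁ T₁ D₁ VD₁} {S₂ : BiKummerSetting X₂ T₂ D₂ VD₂}

/-- **`ψ(u_σ) = u_{Ψ σ}` for a base-identity pre-step `σ`** — abc-iut-w5-d179's `psiVal_frac` for the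
base-equivalent pair of pre-steps `(σ, id)`, whose model fractions are `u_σ · 1⁻¹ = u_σ` and `u_{Ψσ}`.
[cite: MochizukiEtTh2009, Thm 4.4 p.95] -/
theorem Thm44Hyp.psiVal_unit_eq_unit_map (h : Thm44Hyp S₁ S₂) (hF₁ : PreFrobenioid.IsFrobenioid S₁.F)
    (hF₂ : PreFrobenioid.IsFrobenioid S₂.F) (h3 : h.PreservesFrobeniusStructure) {A : S₁.C} (σ : A ⟶ A)
    (hσ : S₁.IsPreStep σ) (hb : ModelFrobenioid.baseMap σ = 𝟙 _) :
    h.psiVal hF₁ hF₂ h3 A (ModelFrobenioid.unit σ) = ModelFrobenioid.unit (h.Ψ.functor.map σ) := by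
  have hB₁ := S₁.tf.isUnit_ratFnFunctor T₁.isUnit_BΛ A
  have hB₂ := S₂.tf.isUnit_ratFnFunctor T₂.isUnit_BΛ (h.Ψ.functor.obj A)
  have hbe : PreFrobenioid.BaseEquivalent S₁.F σ (𝟙 A) := by
    show ModelFrobenioid.baseMap σ = ModelFrobenioid.baseMap (𝟙 A)
    rw [hb, ModelFrobenioid.baseMap_id]
  have e := h.psiVal_frac hF₁ hF₂ h3 σ (𝟙 A) hσ (ModelFrobenioid.isPreStep_id A) hbe hB₁ hB₂
  have e₁ : (ModelFrobenioid.frac hB₁ σ (𝟙 A) : S₁.tf.ratFnFunctor.obj (op A.base)) = ModelFrobenioid.unit σ := by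
    rw [ModelFrobenioid.frac, show ModelFrobenioid.unitU hB₁ (𝟙 A) = 1 from Units.ext rfl, div_one,
      ModelFrobenioid.coe_unitU]
  have e₂ : (ModelFrobenioid.frac hB₂ (h.Ψ.functor.map σ) (h.Ψ.functor.map (𝟙 A)) :
      S₂.tf.ratFnFunctor.obj (op (h.Ψ.functor.obj A).base)) = ModelFrobenioid.unit (h.Ψ.functor.map σ) := by
    rw [ModelFrobenioid.frac, h.Ψ.functor.map_id,
      show ModelFrobenioid.unitU hB₂ (𝟙 (h.Ψ.functor.obj A)) = 1 from Units.ext rfl, div_one,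
      ModelFrobenioid.coe_unitU]
  rw [← e₁, e, e₂]

/-- **`ψ` preserves `Div_B`-triviality**: if `Div_B ξ = 1` then `Div_B(ψ_A ξ) = 1` — `ξ = u_σ` for the base-identity
isometric pre-step `σ = (1, id, 0, ξ)`, `ψ(u_σ) = u_{Ψσ}`, and `Ψσ` is again linear (T44-L03 `h3.1`), base-identity
(`isBaseIdentity_map`) and isometric (`h3.2.1`). [cite: MochizukiEtTh2009, Thm 4.4 p.95] -/
theorem Thm44Hyp.divB_psiVal_eq_one (h : Thm44Hyp S₁ S₂) (hF₁ : PreFrobenioid.IsFrobenioid S₁.F)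
    (hF₂ : PreFrobenioid.IsFrobenioid S₂.F) (h3 : h.PreservesFrobeniusStructure) {A : S₁.C}
    (ξ : S₁.tf.ratFnFunctor.obj (op A.base))
    (hξ : divB S₁.tf.divisorMonoid S₁.tf.ratFnFunctor S₁.tf.divBNatTrans (op A.base) ξ = 1) :
    divB S₂.tf.divisorMonoid S₂.tf.ratFnFunctor S₂.tf.divBNatTrans (op (h.Ψ.functor.obj A).base)
      (h.psiVal hF₁ hF₂ h3 A ξ) = 1 := by
  obtain ⟨σ, hσ, hb, hiso, hu⟩ := exists_preStep_baseIdentity_unit_eq A ξ hξ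
  rw [← hu, h.psiVal_unit_eq_unit_map hF₁ hF₂ h3 σ hσ hb]
  exact divB_unit_eq_one_of_baseIdentity (h.Ψ.functor.map σ) (h.isLinear_map h3 hσ.1)
    (h.isBaseIdentity_map hb) (h3.2.1 σ hiso)

/-- **`ψ` reflects `Div_B`-triviality (surjectively)**: every `ξ₂ ∈ B₂(Ψ(A)^bs)` with `Div_B ξ₂ = 1` is `ψ_A ξ₁`
for some `ξ₁ ∈ B₁(A^bs)` with `Div_B ξ₁ = 1` — `ξ₂ = u_τ` for the base-identity isometric pre-step `τ` of `Ψ(A)`,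
an automorphism; `Ψ` is full and reflects isomorphisms, so `τ = Ψ σ` for an automorphism `σ` of `A`, base-identity
(`isBaseIdentity_of_map`) and isometric (`Φ` sharp); then `ξ₁ := u_σ`. [cite: MochizukiEtTh2009, Thm 4.4 p.95] -/
theorem Thm44Hyp.exists_psiVal_eq_of_divB_eq_one (h : Thm44Hyp S₁ S₂) (hF₁ : PreFrobenioid.IsFrobenioid S₁.F)
    (hF₂ : PreFrobenioid.IsFrobenioid S₂.F) (h3 : h.PreservesFrobeniusStructure) {A : S₁.C}
    (ξ₂ : S₂.tf.ratFnFunctor.obj (op (h.Ψ.functor.obj A).base))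
    (hξ₂ : divB S₂.tf.divisorMonoid S₂.tf.ratFnFunctor S₂.tf.divBNatTrans (op (h.Ψ.functor.obj A).base) ξ₂ = 1) :
    ∃ ξ₁ : S₁.tf.ratFnFunctor.obj (op A.base),
      divB S₁.tf.divisorMonoid S₁.tf.ratFnFunctor S₁.tf.divBNatTrans (op A.base) ξ₁ = 1 ∧
        h.psiVal hF₁ hF₂ h3 A ξ₁ = ξ₂ := by
  have hBg₂ := S₂.tf.isGroupLike_ratFnFunctor T₂.isUnit_BΛ
  obtain ⟨τ, hτ, hbτ, hisoτ, huτ⟩ := exists_preStep_baseIdentity_unit_eq (h.Ψ.functor.obj A) ξ₂ hξ₂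
  haveI : IsIso (ModelFrobenioid.baseMap τ) := by rw [hbτ]; infer_instance
  haveI : IsIso τ := ModelFrobenioid.isIso_of hBg₂ τ hisoτ hτ.1
  let σ : A ≅ A := h.Ψ.functor.preimageIso (asIso τ)
  have hmap : h.Ψ.functor.map σ.hom = τ := by
    rw [Functor.preimageIso_hom, Functor.map_preimage, asIso_hom]
  have hbσ : ModelFrobenioid.baseMap σ.hom = 𝟙 _ := by
    have : S₂.IsBaseIdentity (h.Ψ.functor.map σ.hom) := by rw [hmap]; exact hbτ
    exact h.isBaseIdentity_of_map this
  refine ⟨ModelFrobenioid.unit σ.hom, ?_, ?_⟩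
  · exact divB_unit_eq_one_of_baseIdentity σ.hom (PreFrobenioid.isLinear_of_isIso S₁.F σ.hom) hbσ
      (ModelFrobenioid.div_eq_one_of_isIso hF₁.isPreFrobenioid.isDivisorial σ.hom)
  · rw [h.psiVal_unit_eq_unit_map hF₁ hF₂ h3 σ.hom (PreFrobenioid.isPreStep_of_isIso S₁.F σ.hom) hbσ, hmap, huτ]

/-- **`Base(Ψ φ)` for an arrow over a prescribed `Ψ^bs`-preimage**: if `Base φ = (Ψ^bs)⁻¹(c_A ≫ g ≫ c_B⁻¹)` then
`Base(Ψ φ) = g` (`Base ∘ Ψ ≅ Ψ^bs ∘ Base`, `base_map_Ψ_cmp`). [cite: MochizukiEtTh2009, Thm 4.4 p.93] -/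
theorem Thm44Hyp.baseMap_map_eq_of_baseMap_eq_preimage (h : Thm44Hyp S₁ S₂) {A B : S₁.C} (φ : A ⟶ B)
    (g : S₂.base.obj (h.Ψ.functor.obj A) ⟶ S₂.base.obj (h.Ψ.functor.obj B))
    (hφ : S₁.base.map φ = h.Ψbs.functor.preimage ((h.cmp A).hom ≫ g ≫ (h.cmp B).inv)) :
    S₂.base.map (h.Ψ.functor.map φ) = g := by
  rw [h.base_map_Ψ_cmp φ, hφ, h.Ψbs.functor.map_preimage]
  simp only [Category.assoc, Iso.inv_hom_id, Category.comp_id, Iso.inv_hom_id_assoc]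

/-! ### The transport of the roots reading along `Ψ` (ANY pair of settings) -/

/-- **(⇒) of T44-L15b at the roots reading, for any pair of settings**: if every `Div_B`-trivial element of
`B₁(A_{⊙,1}^bs)` acquires `N`-th roots in `B₁(A''^bs)` along every base arrow (`A''` Frobenius-trivial), then every
`Div_B`-trivial element of `B₂(A_{⊙,2}^bs)` acquires `N`-th roots in `B₂(B''^bs)` along every base arrow, for any
`B'' ≅ Ψ(A'')` — transport through `ψ⁻¹` at `A_⊙`, a `C₁`-arrow over the matching base arrow, `ψ_{A''}` and
`B₂(Base e)`. [cite: MochizukiEtTh2009, Thm 4.4 p.95] -/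
theorem Thm44Hyp.rootsReading_map (h : Thm44Hyp S₁ S₂) (hF₁ : PreFrobenioid.IsFrobenioid S₁.F)
    (hF₂ : PreFrobenioid.IsFrobenioid S₂.F) (h3 : h.PreservesFrobeniusStructure) {A'' : S₁.C} {B'' : S₂.C}
    (hft : S₁.IsFrobeniusTrivial A'') (e : h.Ψ.functor.obj A'' ≅ B'') (N : ℕ)
    (ε : (h.Ψ.functor.obj S₁.Aodot).base ≅ S₂.Aodot.base)
    (hNH₁ : ∀ (g : A''.base ⟶ S₁.Aodot.base) (x : S₁.tf.ratFnFunctor.obj (op S₁.Aodot.base)),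
      divB S₁.tf.divisorMonoid S₁.tf.ratFnFunctor S₁.tf.divBNatTrans (op S₁.Aodot.base) x = 1 →
        ∃ ζ : S₁.tf.ratFnFunctor.obj (op A''.base), ζ ^ N = pull S₁.tf.ratFnFunctor g x)
    (g₂ : B''.base ⟶ S₂.Aodot.base) (ξ₂ : S₂.tf.ratFnFunctor.obj (op S₂.Aodot.base))
    (hξ₂ : divB S₂.tf.divisorMonoid S₂.tf.ratFnFunctor S₂.tf.divBNatTrans (op S₂.Aodot.base) ξ₂ = 1) :
    ∃ ζ : S₂.tf.ratFnFunctor.obj (op B''.base), ζ ^ N = pull S₂.tf.ratFnFunctor g₂ ξ₂ := by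
  have hBg₁ := S₁.tf.isGroupLike_ratFnFunctor T₁.isUnit_BΛ
  -- move `ξ₂` to `Ψ(A_{⊙,1})^bs`, then through `ψ⁻¹` to `A_{⊙,1}^bs`
  have hξ₂' : divB S₂.tf.divisorMonoid S₂.tf.ratFnFunctor S₂.tf.divBNatTrans (op (h.Ψ.functor.obj S₁.Aodot).base)
      (pull S₂.tf.ratFnFunctor ε.hom ξ₂) = 1 := by
    rw [← ModelFrobenioid.pullGp_divB_pull, hξ₂, map_one]
  obtain ⟨ξ₁, hξ₁, hψξ₁⟩ := h.exists_psiVal_eq_of_divB_eq_one hF₁ hF₂ h3 (pull S₂.tf.ratFnFunctor ε.hom ξ₂) hξ₂'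
  -- the base arrow downstairs matching `Base e ≫ g₂ ≫ ε⁻¹`, and a `C₁`-arrow over it
  obtain ⟨φ₁, hφ₁⟩ := exists_hom_baseMap_eq_of_isFrobeniusTrivial hBg₁ hft S₁.isFrobeniusTrivial_Aodot
    (h.Ψbs.functor.preimage ((h.cmp A'').hom ≫ (ModelFrobenioid.baseMap e.hom ≫ g₂ ≫ ε.inv) ≫ (h.cmp S₁.Aodot).inv))
  have hΨφ₁ : ModelFrobenioid.baseMap (h.Ψ.functor.map φ₁) = ModelFrobenioid.baseMap e.hom ≫ g₂ ≫ ε.inv :=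
    h.baseMap_map_eq_of_baseMap_eq_preimage φ₁ _ hφ₁
  -- the root downstairs, transported by `ψ_{A''}` and moved along `Base e⁻¹`
  obtain ⟨ζ₁, hζ₁⟩ := hNH₁ (ModelFrobenioid.baseMap φ₁) ξ₁ hξ₁
  refine ⟨pull S₂.tf.ratFnFunctor (ModelFrobenioid.baseMap e.inv) (h.psiVal hF₁ hF₂ h3 A'' ζ₁), ?_⟩
  rw [← map_pow, ← map_pow, hζ₁]
  change pull S₂.tf.ratFnFunctor (ModelFrobenioid.baseMap e.inv)
      (h.psiVal hF₁ hF₂ h3 A'' ((S₁.tf.ratFnFunctor.map (ModelFrobenioid.baseMap φ₁).op).hom ξ₁)) = _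
  rw [h.psiVal_map_baseMap hF₁ hF₂ h3 φ₁ ξ₁, hψξ₁, hΨφ₁]
  change pull S₂.tf.ratFnFunctor (ModelFrobenioid.baseMap e.inv)
      (pull S₂.tf.ratFnFunctor (ModelFrobenioid.baseMap e.hom ≫ g₂ ≫ ε.inv) (pull S₂.tf.ratFnFunctor ε.hom ξ₂)) =
    pull S₂.tf.ratFnFunctor g₂ ξ₂
  have he : ModelFrobenioid.baseMap e.inv ≫ ModelFrobenioid.baseMap e.hom = 𝟙 _ := by
    rw [← ModelFrobenioid.baseMap_comp, e.inv_hom_id, ModelFrobenioid.baseMap_id]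
  have hc : (ModelFrobenioid.baseMap e.inv ≫ ModelFrobenioid.baseMap e.hom ≫ g₂ ≫ ε.inv) ≫ ε.hom = g₂ := by
    simp only [Category.assoc, Iso.inv_hom_id, Category.comp_id]
    rw [← Category.assoc, he, Category.id_comp]
  rw [← pull_comp, ← pull_comp, hc]

/-- **(⇐) of T44-L15b at the roots reading, for any pair of settings**: conversely, roots upstairs along
`Base(e⁻¹) ≫ Base(Ψ φ₁) ≫ ε` pull back through `B₂(Base e)` and `ψ_{A''}⁻¹` to roots downstairs along `Base φ₁`
(`ψ` injective). [cite: MochizukiEtTh2009, Thm 4.4 p.95] -/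
theorem Thm44Hyp.rootsReading_of_map (h : Thm44Hyp S₁ S₂) (hF₁ : PreFrobenioid.IsFrobenioid S₁.F)
    (hF₂ : PreFrobenioid.IsFrobenioid S₂.F) (h3 : h.PreservesFrobeniusStructure) {A'' : S₁.C} {B'' : S₂.C}
    (hft : S₁.IsFrobeniusTrivial A'') (e : h.Ψ.functor.obj A'' ≅ B'') (N : ℕ)
    (ε : (h.Ψ.functor.obj S₁.Aodot).base ≅ S₂.Aodot.base)
    (hNH₂ : ∀ (g : B''.base ⟶ S₂.Aodot.base) (x : S₂.tf.ratFnFunctor.obj (op S₂.Aodot.base)),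
      divB S₂.tf.divisorMonoid S₂.tf.ratFnFunctor S₂.tf.divBNatTrans (op S₂.Aodot.base) x = 1 →
        ∃ ζ : S₂.tf.ratFnFunctor.obj (op B''.base), ζ ^ N = pull S₂.tf.ratFnFunctor g x)
    (g₁ : A''.base ⟶ S₁.Aodot.base) (ξ₁ : S₁.tf.ratFnFunctor.obj (op S₁.Aodot.base))
    (hξ₁ : divB S₁.tf.divisorMonoid S₁.tf.ratFnFunctor S₁.tf.divBNatTrans (op S₁.Aodot.base) ξ₁ = 1) :
    ∃ ζ : S₁.tf.ratFnFunctor.obj (op A''.base), ζ ^ N = pull S₁.tf.ratFnFunctor g₁ ξ₁ := by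
  have hBg₁ := S₁.tf.isGroupLike_ratFnFunctor T₁.isUnit_BΛ
  obtain ⟨φ₁, hφ₁⟩ := exists_hom_baseMap_eq_of_isFrobeniusTrivial hBg₁ hft S₁.isFrobeniusTrivial_Aodot g₁
  have hξ₂ : divB S₂.tf.divisorMonoid S₂.tf.ratFnFunctor S₂.tf.divBNatTrans (op S₂.Aodot.base)
      (pull S₂.tf.ratFnFunctor ε.inv (h.psiVal hF₁ hF₂ h3 S₁.Aodot ξ₁)) = 1 := by
    rw [← ModelFrobenioid.pullGp_divB_pull, h.divB_psiVal_eq_one hF₁ hF₂ h3 ξ₁ hξ₁, map_one]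
  obtain ⟨ζ₂, hζ₂⟩ := hNH₂ (ModelFrobenioid.baseMap e.inv ≫ ModelFrobenioid.baseMap (h.Ψ.functor.map φ₁) ≫ ε.hom)
    (pull S₂.tf.ratFnFunctor ε.inv (h.psiVal hF₁ hF₂ h3 S₁.Aodot ξ₁)) hξ₂
  -- `ζ₂' := B₂(Base e) ζ₂` is an `N`-th root of `ψ_{A''}(B₁(g₁) ξ₁)`
  have hζ₂' : (pull S₂.tf.ratFnFunctor (ModelFrobenioid.baseMap e.hom) ζ₂) ^ N =
      h.psiVal hF₁ hF₂ h3 A'' (pull S₁.tf.ratFnFunctor g₁ ξ₁) := by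
    rw [← map_pow, hζ₂, ← hφ₁]
    change _ = h.psiVal hF₁ hF₂ h3 A'' ((S₁.tf.ratFnFunctor.map (ModelFrobenioid.baseMap φ₁).op).hom ξ₁)
    rw [h.psiVal_map_baseMap hF₁ hF₂ h3 φ₁ ξ₁]
    change pull S₂.tf.ratFnFunctor (ModelFrobenioid.baseMap e.hom)
        (pull S₂.tf.ratFnFunctor
          (ModelFrobenioid.baseMap e.inv ≫ ModelFrobenioid.baseMap (h.Ψ.functor.map φ₁) ≫ ε.hom)
          (pull S₂.tf.ratFnFunctor ε.inv (h.psiVal hF₁ hF₂ h3 S₁.Aodot ξ₁))) =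
      pull S₂.tf.ratFnFunctor (ModelFrobenioid.baseMap (h.Ψ.functor.map φ₁)) (h.psiVal hF₁ hF₂ h3 S₁.Aodot ξ₁)
    have he : ModelFrobenioid.baseMap e.hom ≫ ModelFrobenioid.baseMap e.inv = 𝟙 _ := by
      rw [← ModelFrobenioid.baseMap_comp, e.hom_inv_id, ModelFrobenioid.baseMap_id]
    have hc : (ModelFrobenioid.baseMap e.hom ≫
        ModelFrobenioid.baseMap e.inv ≫ ModelFrobenioid.baseMap (h.Ψ.functor.map φ₁) ≫ ε.hom) ≫ ε.inv =
          ModelFrobenioid.baseMap (h.Ψ.functor.map φ₁) := by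
      simp only [Category.assoc, Iso.hom_inv_id, Category.comp_id]
      rw [← Category.assoc, he, Category.id_comp]
    rw [← pull_comp, ← pull_comp, hc]
  refine ⟨(h.psiVal hF₁ hF₂ h3 A'').symm (pull S₂.tf.ratFnFunctor (ModelFrobenioid.baseMap e.hom) ζ₂), ?_⟩
  apply (h.psiVal hF₁ hF₂ h3 A'').injective
  rw [map_pow, MulEquiv.apply_symm_apply, hζ₂']

end AnySetting

/-! ### T44-L15b at two canonical models carrying the roots reading -/

section Canonical

variable (tf₁ : TemperedFrobenioid T₁ D₁ VD₁) (hZ₁ : tf₁.monoidType = MonoidType.Z)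
  (hP₁ : ∀ A : D₁ᵒᵖ, IsPerfect (tf₁.Φ.carrier A)) (IG₁ : D₁ → Prop) (gS₁ : ∀ A : D₁, IG₁ A → (X₁.Pi →* Aut A))
  (gSs₁ : ∀ (A : D₁) (hA : IG₁ A), Function.Surjective (gS₁ A hA)) (A₀₁ : tf₁.category)
  (hA₀₁ : PreFrobenioid.IsFrobeniusTrivial tf₁.toElem A₀₁) (hA₀₁' : IG₁ A₀₁.base)
  (tf₂ : TemperedFrobenioid T₂ D₂ VD₂) (hZ₂ : tf₂.monoidType = MonoidType.Z)
  (hP₂ : ∀ A : D₂ᵒᵖ, IsPerfect (tf₂.Φ.carrier A)) (IG₂ : D₂ → Prop) (gS₂ : ∀ A : D₂, IG₂ A → (X₂.Pi →* Aut A))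
  (gSs₂ : ∀ (A : D₂) (hA : IG₂ A), Function.Surjective (gS₂ A hA)) (A₀₂ : tf₂.category)
  (hA₀₂ : PreFrobenioid.IsFrobeniusTrivial tf₂.toElem A₀₂) (hA₀₂' : IG₂ A₀₂.base)

/-- **T44-L15b `PreservesNHSaturatedBsFld` PROVED for two canonical models AT THE ROOTS READING of the
`(N, H_⊙^{bs-fld})`-saturation slot** (a reading WEAKER than print's cohomological [FrdII] Def 2.2 (ii)(c); at the
faithful reading the row stays the [FrdII]/[AbsAnab] input): for any `h : Thm44Hyp S₁ S₂` between the canonical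
models with `NH_i := «Div_B-trivial elements of B_i(A_{⊙,i}^bs) acquire N-th roots in B_i(A^bs) along every
A^bs ⟶ A_{⊙,i}^bs»`, a Frobenius-trivial `A''` satisfies `NH₁` at `N` iff any `B'' ≅ Ψ(A'')` satisfies `NH₂` at `N` —
print's «manifestly category-theoretic nature of (N, H^{bs-fld})-saturation» (p.95 ll.14–16) as a theorem at the
reading; inputs "`C_i` Frobenioid" and T44-L03 only. [cite: MochizukiEtTh2009, Thm 4.4 p.95] -/
theorem Thm44Hyp.preservesNHSaturatedBsFld_rootsReading
    (h : Thm44Hyp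
      (mkOfModelCanonical X₁ tf₁ hZ₁ hP₁ IG₁ gS₁ gSs₁
        (fun _ A M => ∀ (g : A.base ⟶ A₀₁.base) (x : tf₁.ratFnFunctor.obj (op A₀₁.base)),
          divB tf₁.divisorMonoid tf₁.ratFnFunctor tf₁.divBNatTrans (op A₀₁.base) x = 1 →
            ∃ ζ : tf₁.ratFnFunctor.obj (op A.base), ζ ^ (M : ℕ) = pull tf₁.ratFnFunctor g x)
        A₀₁ hA₀₁ hA₀₁')
      (mkOfModelCanonical X₂ tf₂ hZ₂ hP₂ IG₂ gS₂ gSs₂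
        (fun _ A M => ∀ (g : A.base ⟶ A₀₂.base) (x : tf₂.ratFnFunctor.obj (op A₀₂.base)),
          divB tf₂.divisorMonoid tf₂.ratFnFunctor tf₂.divBNatTrans (op A₀₂.base) x = 1 →
            ∃ ζ : tf₂.ratFnFunctor.obj (op A.base), ζ ^ (M : ℕ) = pull tf₂.ratFnFunctor g x)
        A₀₂ hA₀₂ hA₀₂'))
    (hF₁ : PreFrobenioid.IsFrobenioid tf₁.toElem) (hF₂ : PreFrobenioid.IsFrobenioid tf₂.toElem)
    (h3 : h.PreservesFrobeniusStructure) :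
    h.PreservesNHSaturatedBsFld := by
  intro A'' B'' N hft hisom
  obtain ⟨e⟩ := hisom
  obtain ⟨ε₀⟩ := h.mapsAodot
  exact ⟨fun hNH₁ g₂ ξ₂ hξ₂ => h.rootsReading_map hF₁ hF₂ h3 hft e N ((h.cmp A₀₁).symm ≪≫ ε₀) hNH₁ g₂ ξ₂ hξ₂,
    fun hNH₂ g₁ ξ₁ hξ₁ => h.rootsReading_of_map hF₁ hF₂ h3 hft e N ((h.cmp A₀₁).symm ≪≫ ε₀) hNH₂ g₁ ξ₁ hξ₁⟩

end Canonical


/-! ### T44-L14 at the canonical tree-vocabulary models AT THE ROOTS READING: T44-L15b discharged -/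

section CanonicalTree

variable {T₁' : RealifiedDivisorMonoids (D₀ := D₀) treeMonoidVocab.{w}}
  {T₂' : RealifiedDivisorMonoids (D₀ := D₀') treeMonoidVocab.{w}}
  {IsRational₁ IsStrictlyRational₁ : (D₁ᵒᵖ ⥤ CommMonCat.{w}) → Prop}
  {IsRational₂ IsStrictlyRational₂ : (D₂ᵒᵖ ⥤ CommMonCat.{w}) → Prop}
  {tf₁ : TemperedFrobenioid T₁' D₁ (treeCatVocab D₁ IsRational₁ IsStrictlyRational₁)}
  {hZ₁ : tf₁.monoidType = MonoidType.Z} {hP₁ : ∀ A : D₁ᵒᵖ, IsPerfect (tf₁.Φ.carrier A)}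
  {IG₁ : D₁ → Prop} {gS₁ : ∀ A : D₁, IG₁ A → (X₁.Pi →* Aut A)}
  {gSs₁ : ∀ (A : D₁) (hA : IG₁ A), Function.Surjective (gS₁ A hA)} {A₀₁ : tf₁.category}
  {hA₀₁ : PreFrobenioid.IsFrobeniusTrivial tf₁.toElem A₀₁} {hA₀₁' : IG₁ A₀₁.base}
  {tf₂ : TemperedFrobenioid T₂' D₂ (treeCatVocab D₂ IsRational₂ IsStrictlyRational₂)}
  {hZ₂ : tf₂.monoidType = MonoidType.Z} {hP₂ : ∀ A : D₂ᵒᵖ, IsPerfect (tf₂.Φ.carrier A)}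
  {IG₂ : D₂ → Prop} {gS₂ : ∀ A : D₂, IG₂ A → (X₂.Pi →* Aut A)}
  {gSs₂ : ∀ (A : D₂) (hA : IG₂ A), Function.Surjective (gS₂ A hA)} {A₀₂ : tf₂.category}
  {hA₀₂ : PreFrobenioid.IsFrobeniusTrivial tf₂.toElem A₀₂} {hA₀₂' : IG₂ A₀₂.base}

/-- **T44-L14 "`Ψ` maps `N`-th roots of fraction-pairs to `N`-th roots" at the canonical model instances AT THE
ROOTS READING ⇐ {`Remark372 D₀ / D₀'` (Rmk 3.7.2), `hBmon₁ / hBmon₂`, `Φ_i` perf-factorial, T44-L09c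
`GaloisCompatible`} ONLY** — abc-iut-w5-d179's `preservesNthRoots_mkOfModelCanonical` (p429785) with its last
binder T44-L15b DISCHARGED by `preservesNHSaturatedBsFld_rootsReading` (the `(N, H_⊙^{bs-fld})`-saturation slots of
both models being the roots readings; WEAKER than print's cohomological [FrdII] Def 2.2 (ii)(c)).
[cite: MochizukiEtTh2009, Thm 4.4 p.94] -/
theorem Thm44Hyp.preservesNthRoots_mkOfModelCanonical_rootsReading
    (h : Thm44Hyp
      (mkOfModelCanonical X₁ tf₁ hZ₁ hP₁ IG₁ gS₁ gSs₁
        (fun _ A M => ∀ (g : A.base ⟶ A₀₁.base) (x : tf₁.ratFnFunctor.obj (op A₀₁.base)),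
          divB tf₁.divisorMonoid tf₁.ratFnFunctor tf₁.divBNatTrans (op A₀₁.base) x = 1 →
            ∃ ζ : tf₁.ratFnFunctor.obj (op A.base), ζ ^ (M : ℕ) = pull tf₁.ratFnFunctor g x)
        A₀₁ hA₀₁ hA₀₁')
      (mkOfModelCanonical X₂ tf₂ hZ₂ hP₂ IG₂ gS₂ gSs₂
        (fun _ A M => ∀ (g : A.base ⟶ A₀₂.base) (x : tf₂.ratFnFunctor.obj (op A₀₂.base)),
          divB tf₂.divisorMonoid tf₂.ratFnFunctor tf₂.divBNatTrans (op A₀₂.base) x = 1 →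
            ∃ ζ : tf₂.ratFnFunctor.obj (op A.base), ζ ^ (M : ℕ) = pull tf₂.ratFnFunctor g x)
        A₀₂ hA₀₂ hA₀₂'))
    (h372 : TemperedFrobenioid.Remark372 D₀) (h372' : TemperedFrobenioid.Remark372 D₀')
    (hBmon₁ : IsMonoidOn tf₁.ratFnFunctor) (hBmon₂ : IsMonoidOn tf₂.ratFnFunctor)
    (hpf₁ : ∀ A : D₁ᵒᵖ, IsPerfFactorial (tf₁.Φ.carrier A))
    (hpf₂ : ∀ A : D₂ᵒᵖ, IsPerfFactorial (tf₂.Φ.carrier A)) (h9 : h.GaloisCompatible) :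
    h.PreservesNthRoots (h.psiModel (tf₁.isFrobenioid_treeCatVocab_of_isMonoidOn hBmon₁)
      (tf₂.isFrobenioid_treeCatVocab_of_isMonoidOn hBmon₂)
      (h.preservesFrobeniusStructure_treeVocab h372 h372' hBmon₁ hBmon₂))
      (fun φ f => tf₁.pullFracModel φ f) (fun φ f => tf₂.pullFracModel φ f) :=
  h.preservesNthRoots_mkOfModelCanonical h372 h372' hBmon₁ hBmon₂ hpf₁ hpf₂ h9
    (Thm44Hyp.preservesNHSaturatedBsFld_rootsReading tf₁ hZ₁ hP₁ IG₁ gS₁ gSs₁ A₀₁ hA₀₁ hA₀₁' tf₂ hZ₂ hP₂ IG₂ gS₂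
      gSs₂ A₀₂ hA₀₂ hA₀₂' h (tf₁.isFrobenioid_treeCatVocab_of_isMonoidOn hBmon₁)
      (tf₂.isFrobenioid_treeCatVocab_of_isMonoidOn hBmon₂) (h.preservesFrobeniusStructure_treeVocab h372 h372' hBmon₁ hBmon₂))

end CanonicalTree

end BiKummerSetting

end Literature.AnabelianGeometry.EtaleTheta

end
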